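import Summits.QuantumFields.YangMills.Theorems.BalabanLadderNTReferencePackageTwoPoint
import HarnessLib

/-!
# Crux `NT` (stmt-QuantumFields-19353): reference-state transfer, VII — a PERIODIC reference: a two-point floor with
# oscillation margin on ONE torus per coupling is clause (i) of `LowerBounds` on EVERY torus

Helper file (`--supports stmt-QuantumFields-19353`) of the fleet lead prover of crux `NT` (unit `ym-spine-19353-p1`,
g4).  Item 2 / D3′ of the crux idea `Cruxes/NT/Ideas/reference-state-transfer.md`: the reference state may be a
periodic torus of ANY side holding the transfer cube — «LITERALLY the lattices of Bałaban CMP 95–122» — instead of a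
cube kernel with a frozen exterior.  The windowed-floor non-composability recorded on this crux (a floor on the tori of
a window `a(β)·L ∈ [Λ, Λ']` does not by itself give the floor for all large `L`) is resolved exactly by the sign-free
exterior-oscillation ceilings: two tori holding the same femto transfer cube have smeared truncated two-point
functions within `2 h_{θv} h_v + w_{θv,v}` of each other (`abs_torusCov_sub_torusCov_le`, D3′ two-sided, from the
torus DLR step and the oscillation-form law of total covariance of file I).

* `abs_torusCov_sub_torusCov_le` — general cylinder observables, two tori of sides `≥ b₀ + 3`;
* `abs_torusCov_dens_sub_torusCov_dens_le` — two action densities at sites of depth `≥ 1`;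
* `pair_transfer_torus` — per pair of support sites at coupling `β`;
* `lowerBounds_fst_of_torusReference` — (E1-osc) ∧ (E2-osc) ∧ «for `β ≥ β₅` ONE torus `2L₀(β)+1` with
  `a β · L₀(β) ≥ σ + κ + 1` on which `Q2_{β,L₀(β),aβ}(θv, v) ≥ ε +` margin» ⇒ clause (i) of `LowerBounds G r a` with
  `Λ₅ = σ + κ + 1`.

Refs: card `Cruxes/NT/Ideas/reference-state-transfer.md` §Mechanism 2 (D3′), §Why it bites here (B12, FS non-composability).
-/

set_option autoImplicit false

noncomputable section

open scoped SchwartzMap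
open MeasureTheory Filter Topology
open Literature.MathematicalPhysics.QuantumFieldTheory Literature.MathematicalPhysics.QuantumLattice
open Literature.Probability.LatticeModels
open Summit.QuantumFields.YangMills.Cruxes.OSLegsFromFemtoAndGap.DlrCollarTransfer
open Summit.QuantumFields.YangMills.Cruxes.OSLegsFromFemtoAndGap.DlrCollarTransfer.StubLower
  (isCylinder_dens exists_abs_dens_le)

namespace Summit.QuantumFields.YangMills.Cruxes.NT.Reference

section Torus

variable (G : Type) [Group G] [TopologicalSpace G] [IsTopologicalGroup G] [CompactSpace G]
  [MeasurableSpace G] [BorelSpace G] (r : LatticeRep G)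

/-- **D3′, two-sided — two tori compared.**  A cube `P = (c₀, b₀)` inside two tori of ANY sides
`2L+1, 2L'+1 ≥ b₀ + 3`, cylinder observables `F, G'` windowed in `P` with oscillations `h, h', ω` as above:
`|torusCov_L(F,G') − torusCov_{L'}(F,G')| ≤ 2 h h' + ω`.  (A floor on ONE torus per coupling, with this margin,
is a floor on every torus holding the transfer cube.) [folklore] -/
theorem abs_torusCov_sub_torusCov_le (β : ℝ) (c₀ : Fin 4 → ℤ) (b₀ L L' : ℕ) (hL : b₀ + 3 ≤ 2 * L + 1)
    (hL' : b₀ + 3 ≤ 2 * L' + 1)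
    {F G' : LGConfig 4 G → ℝ} (hFc : Continuous F) (hGc : Continuous G') {MF MG : ℝ}
    (hMF : ∀ U, |F U| ≤ MF) (hMG : ∀ U, |G' U| ≤ MG)
    {SF SG : Finset (Literature.MathematicalPhysics.QuantumLattice.ZdEdge 4)}
    (hFS : IsCylinder F SF) (hGS : IsCylinder G' SG)
    (hSF : ∀ e ∈ SF, ∀ j, c₀ j ≤ e.1 j ∧ e.1 j ≤ c₀ j + b₀)
    (hSG : ∀ e ∈ SG, ∀ j, c₀ j ≤ e.1 j ∧ e.1 j ≤ c₀ j + b₀) {h h' ω : ℝ}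
    (hoF : ∀ ζ ζ', |kerE G r β c₀ b₀ ζ F - kerE G r β c₀ b₀ ζ' F| ≤ h)
    (hoG : ∀ ζ ζ', |kerE G r β c₀ b₀ ζ G' - kerE G r β c₀ b₀ ζ' G'| ≤ h')
    (hoC : ∀ ζ ζ', |kerCov G r β c₀ b₀ ζ F G' - kerCov G r β c₀ b₀ ζ' F G'| ≤ ω) :
    |(torusE G r β L (fun U => F U * G' U) - torusE G r β L F * torusE G r β L G')
      - (torusE G r β L' (fun U => F U * G' U) - torusE G r β L' F * torusE G r β L' G')| ≤
      2 * h * h' + ω := by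
  haveI := r.secondCountableTopology
  haveI := isProbabilityMeasure_wilsonMeasure (d := 4) (L := 2 * L + 1) r.ρ r.continuous β
  haveI := isProbabilityMeasure_wilsonMeasure (d := 4) (L := 2 * L' + 1) r.ρ r.continuous β
  have t1 := abs_torusCov_sub_torusE_kerCov_le G r β c₀ b₀ L hL hFc hGc hMF hMG hFS hGS hSF hSG hoF hoG
  have t2 := abs_torusCov_sub_torusE_kerCov_le G r β c₀ b₀ L' hL' hFc hGc hMF hMG hFS hGS hSF hSG hoF hoG
  have hcont := continuous_kerCov G r β c₀ b₀ hFc hGc hMF hMG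
  have t3 : |torusE G r β L (fun ζ => kerCov G r β c₀ b₀ ζ F G') -
      torusE G r β L' (fun ζ => kerCov G r β c₀ b₀ ζ F G')| ≤ ω := by
    unfold torusE
    exact abs_integral_sub_integral_le_of_osc (hcont.comp (continuous_torusLift _))
      (hcont.comp (continuous_torusLift _)) (fun U V => hoC _ _)
  have tri := abs_sub_le
    (torusE G r β L (fun U => F U * G' U) - torusE G r β L F * torusE G r β L G')
    (torusE G r β L (fun ζ => kerCov G r β c₀ b₀ ζ F G'))
    (torusE G r β L' (fun U => F U * G' U) - torusE G r β L' F * torusE G r β L' G')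
  have tri₂ := abs_sub_le (torusE G r β L (fun ζ => kerCov G r β c₀ b₀ ζ F G'))
    (torusE G r β L' (fun ζ => kerCov G r β c₀ b₀ ζ F G'))
    (torusE G r β L' (fun U => F U * G' U) - torusE G r β L' F * torusE G r β L' G')
  rw [abs_sub_comm] at t2
  linarith


/-- **Two tori compared, two action densities.**  A cube `P = (c₀, b₀)` inside two tori of sides `2L+1, 2L'+1 ≥
b₀ + 3`, sites `x, y` of depth `≥ 1` in `P`, exterior oscillations `h_x, h_y` (one-point) and `ω` (covariance) of the
`P`-kernel data: `|torusCov_L(dens x, dens y) − torusCov_{L'}(dens x, dens y)| ≤ 2 h_x h_y + ω`. [folklore] -/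
theorem abs_torusCov_dens_sub_torusCov_dens_le (β : ℝ) (c₀ : Fin 4 → ℤ) (b₀ L L' : ℕ) (hL : b₀ + 3 ≤ 2 * L + 1)
    (hL' : b₀ + 3 ≤ 2 * L' + 1) {x y : Fin 4 → ℤ} (hx : 1 ≤ depth c₀ b₀ x) (hy : 1 ≤ depth c₀ b₀ y)
    {hx' hy' ω : ℝ}
    (hox : ∀ ζ ζ', |kerE G r β c₀ b₀ ζ (dens G r x) - kerE G r β c₀ b₀ ζ' (dens G r x)| ≤ hx')
    (hoy : ∀ ζ ζ', |kerE G r β c₀ b₀ ζ (dens G r y) - kerE G r β c₀ b₀ ζ' (dens G r y)| ≤ hy')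
    (hoC : ∀ ζ ζ', |kerCov G r β c₀ b₀ ζ (dens G r x) (dens G r y) -
      kerCov G r β c₀ b₀ ζ' (dens G r x) (dens G r y)| ≤ ω) :
    |(torusE G r β L (fun U => dens G r x U * dens G r y U) - torusE G r β L (dens G r x) * torusE G r β L (dens G r y))
      - (torusE G r β L' (fun U => dens G r x U * dens G r y U) -
          torusE G r β L' (dens G r x) * torusE G r β L' (dens G r y))| ≤ 2 * hx' * hy' + ω := by
  obtain ⟨M, -, hM⟩ := exists_abs_dens_le G r
  exact abs_torusCov_sub_torusCov_le G r β c₀ b₀ L L' hL hL' (continuous_dens r x) (continuous_dens r y) (hM x) (hM y)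
    (isCylinder_dens G r x) (isCylinder_dens G r y) (dens_supp_window_of_depth_pos G r hx)
    (dens_supp_window_of_depth_pos G r hy) hox hoy hoC

/-- **Per-pair torus-to-torus transfer at coupling `β`.**  Transfer cube of radius `RP`, femto at `β` for
(E1-osc)/(E2-osc), inside two tori `2L+1`, `2L'+1`; for sites `x, y` of the support box:
`|torusCov_L(dens x, dens y) − torusCov_{L'}(dens x, dens y)| ≤ 2 (C₁ (α/κ)⁴)² + C₂ (α/κ)⁴ / (1 + ‖y−x‖)⁴`. [folklore] -/
theorem pair_transfer_torus (β : ℝ) {C₁ C₂ ℓ κ α : ℝ} (hC₁ : 0 ≤ C₁) (hC₂ : 0 ≤ C₂) (hκ : 0 < κ) (hα : 0 < α)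
    {RP L L' N : ℕ} (hfem : ((2 * RP + 1 : ℕ) : ℝ) * α ≤ ℓ) (hL : 2 * RP + 1 + 3 ≤ 2 * L + 1)
    (hL' : 2 * RP + 1 + 3 ≤ 2 * L' + 1)
    (hdep : ∀ x ∈ box 4 N, κ / α ≤ (depth (fun _ => -(RP : ℤ)) (2 * RP + 1) x : ℝ) ∧
      1 ≤ depth (fun _ => -(RP : ℤ)) (2 * RP + 1) x)
    (H1 : ∀ (c : Fin 4 → ℤ) (b : ℕ), (b : ℝ) * α ≤ ℓ → ∀ (η η' : LGConfig 4 G) (x : Fin 4 → ℤ), 1 ≤ depth c b x →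
      |kerE G r β c b η (dens G r x) - kerE G r β c b η' (dens G r x)| ≤ C₁ / (depth c b x : ℝ) ^ 4)
    (H2 : ∀ (c : Fin 4 → ℤ) (b : ℕ), (b : ℝ) * α ≤ ℓ → ∀ (η η' : LGConfig 4 G) (x y : Fin 4 → ℤ),
      1 ≤ depth c b x → 1 ≤ depth c b y →
        |kerCov G r β c b η (dens G r x) (dens G r y) - kerCov G r β c b η' (dens G r x) (dens G r y)| ≤
          C₂ / ((min (depth c b x) (depth c b y) : ℕ) : ℝ) ^ 4 / (1 + ‖siteToE (y - x)‖) ^ 4)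
    {x y : Fin 4 → ℤ} (hx : x ∈ box 4 N) (hy : y ∈ box 4 N) :
    |(torusE G r β L (fun U => dens G r x U * dens G r y U) - torusE G r β L (dens G r x) * torusE G r β L (dens G r y))
      - (torusE G r β L' (fun U => dens G r x U * dens G r y U) -
          torusE G r β L' (dens G r x) * torusE G r β L' (dens G r y))| ≤
      2 * (C₁ * (α / κ) ^ 4) * (C₁ * (α / κ) ^ 4) + C₂ * (α / κ) ^ 4 / (1 + ‖siteToE (y - x)‖) ^ 4 := by
  obtain ⟨hxκ, hx1⟩ := hdep x hx
  obtain ⟨hyκ, hy1⟩ := hdep y hy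
  have hox : ∀ ζ ζ', |kerE G r β (fun _ => -(RP : ℤ)) (2 * RP + 1) ζ (dens G r x) -
      kerE G r β (fun _ => -(RP : ℤ)) (2 * RP + 1) ζ' (dens G r x)| ≤ C₁ * (α / κ) ^ 4 := fun ζ ζ' =>
    (H1 _ _ hfem ζ ζ' x hx1).trans (div_pow_depth_le hC₁ hκ hα hxκ)
  have hoy : ∀ ζ ζ', |kerE G r β (fun _ => -(RP : ℤ)) (2 * RP + 1) ζ (dens G r y) -
      kerE G r β (fun _ => -(RP : ℤ)) (2 * RP + 1) ζ' (dens G r y)| ≤ C₁ * (α / κ) ^ 4 := fun ζ ζ' =>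
    (H1 _ _ hfem ζ ζ' y hy1).trans (div_pow_depth_le hC₁ hκ hα hyκ)
  have hpos : 0 < (1 + ‖siteToE (y - x)‖) ^ 4 := by positivity
  have hmin : κ / α ≤ ((min (depth (fun _ => -(RP : ℤ)) (2 * RP + 1) x)
      (depth (fun _ => -(RP : ℤ)) (2 * RP + 1) y) : ℕ) : ℝ) := by
    rw [Nat.cast_min]; exact le_min hxκ hyκ
  have hoC : ∀ ζ ζ', |kerCov G r β (fun _ => -(RP : ℤ)) (2 * RP + 1) ζ (dens G r x) (dens G r y) -
      kerCov G r β (fun _ => -(RP : ℤ)) (2 * RP + 1) ζ' (dens G r x) (dens G r y)| ≤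
      C₂ * (α / κ) ^ 4 / (1 + ‖siteToE (y - x)‖) ^ 4 := fun ζ ζ' =>
    (H2 _ _ hfem ζ ζ' x y hx1 hy1).trans
      (div_le_div_of_nonneg_right (div_pow_depth_le hC₂ hκ hα hmin) hpos.le)
  exact abs_torusCov_dens_sub_torusCov_dens_le G r β _ _ L L' hL hL' hx1 hy1 hox hoy hoC

/-- **Clause (i) of `LowerBounds` from a PERIODIC reference.**  A unit map `a` (`0 < a`, `a → 0`); constants
`C₁, C₂ ≥ 0`, femto scale `ℓ`, support radius `σ > 0`, collar `κ > 0` with `2(σ+κ) < ℓ`; (E1-osc), (E2-osc) as in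
file IV; and (R2-torus): ONE positive-time `v` supported in the ball of radius `σ`, `ε > 0`, and for every `β ≥ β₅`
ONE torus `2L₀(β)+1` with `a β · L₀(β) ≥ σ + κ + 1` on which `Q2_{β,L₀(β),aβ}(θv, v) ≥ ε + 2 h_{θv} h_v + w_{θv,v}`
(lattice margins summed over the box of radius `L₀(β)`).  Then clause (i) of `LowerBounds G r a` holds with the same
`v, ε` and `Λ₅ = σ + κ + 1` — on EVERY torus. [folklore] -/
theorem lowerBounds_fst_of_torusReference (a : ℝ → ℝ) (ha₀ : ∀ β, 0 < a β) (ha : Tendsto a atTop (𝓝 0))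
    {C₁ C₂ ℓ σ κ : ℝ} (hC₁ : 0 ≤ C₁) (hC₂ : 0 ≤ C₂) (hσ : 0 < σ) (hκ : 0 < κ) (hℓ : 2 * (σ + κ) < ℓ)
    (hE1 : ∃ β₁ : ℝ, ∀ β : ℝ, β₁ ≤ β → ∀ (c : Fin 4 → ℤ) (b : ℕ), (b : ℝ) * a β ≤ ℓ →
      ∀ (η η' : LGConfig 4 G) (x : Fin 4 → ℤ), 1 ≤ depth c b x →
        |kerE G r β c b η (dens G r x) - kerE G r β c b η' (dens G r x)| ≤ C₁ / (depth c b x : ℝ) ^ 4)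
    (hE2 : ∃ β₂ : ℝ, ∀ β : ℝ, β₂ ≤ β → ∀ (c : Fin 4 → ℤ) (b : ℕ), (b : ℝ) * a β ≤ ℓ →
      ∀ (η η' : LGConfig 4 G) (x y : Fin 4 → ℤ), 1 ≤ depth c b x → 1 ≤ depth c b y →
        |kerCov G r β c b η (dens G r x) (dens G r y) - kerCov G r β c b η' (dens G r x) (dens G r y)| ≤
          C₂ / ((min (depth c b x) (depth c b y) : ℕ) : ℝ) ^ 4 / (1 + ‖siteToE (y - x)‖) ^ 4)
    (hR2 : ∃ (v : 𝓢(EuclideanSpace ℝ (Fin 4), ℝ)) (ε β₅ : ℝ) (L₀ : ℝ → ℕ),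
      tsupport (v : EuclideanSpace ℝ (Fin 4) → ℝ) ⊆ {y | 0 < y 0} ∧
      tsupport (v : EuclideanSpace ℝ (Fin 4) → ℝ) ⊆ Metric.closedBall 0 σ ∧ 0 < ε ∧
      ∀ β : ℝ, β₅ ≤ β → σ + κ + 1 ≤ a β * L₀ β ∧
        ε + 2 * (C₁ * (a β / κ) ^ 4 * ∑ x ∈ box 4 (L₀ β), |thetaTest 4 v (a β • siteToE x)|) *
              (C₁ * (a β / κ) ^ 4 * ∑ y ∈ box 4 (L₀ β), |v (a β • siteToE y)|) +
            C₂ * (a β / κ) ^ 4 * ∑ x ∈ box 4 (L₀ β), ∑ y ∈ box 4 (L₀ β),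
              |thetaTest 4 v (a β • siteToE x)| * |v (a β • siteToE y)| / (1 + ‖siteToE (y - x)‖) ^ 4 ≤
          Q2 G r β (L₀ β) (a β) (thetaTest 4 v) v) :
    ∃ (v : 𝓢(EuclideanSpace ℝ (Fin 4), ℝ)) (ε β₅ Λ₅ : ℝ),
      tsupport (v : EuclideanSpace ℝ (Fin 4) → ℝ) ⊆ {y : EuclideanSpace ℝ (Fin 4) | 0 < y 0} ∧ 0 < ε ∧
      ∀ β : ℝ, β₅ ≤ β → ∀ L : ℕ, Λ₅ ≤ a β * L → ε ≤ Q2 G r β L (a β) (thetaTest 4 v) v := by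
  obtain ⟨β₁, H1⟩ := hE1
  obtain ⟨β₂, H2⟩ := hE2
  obtain ⟨v, ε, β₅, L₀, hvpos, hvσ, hε, HR⟩ := hR2
  have hδ : 0 < min (1 / 4 : ℝ) ((ℓ - 2 * (σ + κ)) / 5) := lt_min (by norm_num) (by linarith)
  obtain ⟨βa, Ha⟩ := eventually_le_of_tendsto ha hδ
  refine ⟨v, ε, max (max β₅ βa) (max β₁ β₂), σ + κ + 1, hvpos, hε, fun β hβ L hL => ?_⟩
  have hβ₅ : β₅ ≤ β := le_trans (le_max_left _ _) (le_trans (le_max_left _ _) hβ)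
  have hβa : βa ≤ β := le_trans (le_max_right _ _) (le_trans (le_max_left _ _) hβ)
  have hβ₁ : β₁ ≤ β := le_trans (le_max_left _ _) (le_trans (le_max_right _ _) hβ)
  have hβ₂ : β₂ ≤ β := le_trans (le_max_right _ _) (le_trans (le_max_right _ _) hβ)
  have hα : 0 < a β := ha₀ β
  have hsmall := Ha β hβa
  have h4 : a β ≤ 1 / 4 := hsmall.trans (min_le_left _ _)
  have hℓ' : a β ≤ (ℓ - 2 * (σ + κ)) / 5 := hsmall.trans (min_le_right _ _)
  have hρ' : a β ≤ ((σ + κ + 2 * a β) - σ - κ) / 2 := by linarith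
  obtain ⟨hL₀, HRβ⟩ := HR β hβ₅
  obtain ⟨-, hfem, hLL, hNL, -, hdep⟩ := scales hα hσ hκ h4 hρ' hℓ' hL (RP := ⌈(σ + κ) / a β⌉₊ + 1) rfl
  obtain ⟨-, -, hLL₀, hNL₀, -, -⟩ := scales hα hσ hκ h4 hρ' hℓ' hL₀ (RP := ⌈(σ + κ) / a β⌉₊ + 1) rfl
  set N := ⌈σ / a β⌉₊ with hN
  have hθ0 : ∀ x, x ∉ box 4 N → thetaTest 4 v (a β • siteToE x) = 0 := fun x hx =>
    thetaTest_smul_siteToE_eq_zero hα hvσ hx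
  have hw0 : ∀ y, y ∉ box 4 N → v (a β • siteToE y) = 0 := fun y hy =>
    apply_smul_siteToE_eq_zero hα hvσ hy
  -- per-pair torus-to-torus transfer
  have hpair : ∀ x ∈ box 4 N, ∀ y ∈ box 4 N,
      |(torusE G r β L (fun U => dens G r x U * dens G r y U) - torusE G r β L (dens G r x) * torusE G r β L (dens G r y))
        - (torusE G r β (L₀ β) (fun U => dens G r x U * dens G r y U) -
            torusE G r β (L₀ β) (dens G r x) * torusE G r β (L₀ β) (dens G r y))| ≤
      2 * (C₁ * (a β / κ) ^ 4) * (C₁ * (a β / κ) ^ 4) + C₂ * (a β / κ) ^ 4 / (1 + ‖siteToE (y - x)‖) ^ 4 :=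
    fun x hx y hy => pair_transfer_torus G r β hC₁ hC₂ hκ hα hfem hLL hLL₀ hdep (H1 β hβ₁) (H2 β hβ₂) hx hy
  -- the sums restricted to the support box
  have eQ : ∀ M : ℕ, N ≤ M → Q2 G r β M (a β) (thetaTest 4 v) v = ∑ x ∈ box 4 N, ∑ y ∈ box 4 N,
      thetaTest 4 v (a β • siteToE x) * v (a β • siteToE y) *
        (torusE G r β M (fun U => dens G r x U * dens G r y U) -
          torusE G r β M (dens G r x) * torusE G r β M (dens G r y)) := fun M hM => by
    unfold Q2
    exact sum_box₂_eq hM _ (fun x hx y => by rw [hθ0 x hx]; ring) (fun y hy x => by rw [hw0 y hy]; ring)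
  have e1 : ∑ x ∈ box 4 (L₀ β), |thetaTest 4 v (a β • siteToE x)| =
      ∑ x ∈ box 4 N, |thetaTest 4 v (a β • siteToE x)| :=
    sum_box_eq_sum_box hNL₀ _ fun x hx => by rw [hθ0 x hx, abs_zero]
  have e2 : ∑ y ∈ box 4 (L₀ β), |v (a β • siteToE y)| = ∑ y ∈ box 4 N, |v (a β • siteToE y)| :=
    sum_box_eq_sum_box hNL₀ _ fun y hy => by rw [hw0 y hy, abs_zero]
  have e3 : ∑ x ∈ box 4 (L₀ β), ∑ y ∈ box 4 (L₀ β),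
      |thetaTest 4 v (a β • siteToE x)| * |v (a β • siteToE y)| / (1 + ‖siteToE (y - x)‖) ^ 4 =
      ∑ x ∈ box 4 N, ∑ y ∈ box 4 N,
      |thetaTest 4 v (a β • siteToE x)| * |v (a β • siteToE y)| / (1 + ‖siteToE (y - x)‖) ^ 4 :=
    sum_box₂_eq hNL₀ _ (fun x hx y => by rw [hθ0 x hx, abs_zero, zero_mul, zero_div])
      (fun y hy x => by rw [hw0 y hy, abs_zero, mul_zero, zero_div])
  have hsum := sum_sum_sub_le_of_abs_sub_le (box 4 N) (fun x => thetaTest 4 v (a β • siteToE x))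
    (fun y => v (a β • siteToE y))
    (fun x y => torusE G r β L (fun U => dens G r x U * dens G r y U) -
      torusE G r β L (dens G r x) * torusE G r β L (dens G r y))
    (fun x y => torusE G r β (L₀ β) (fun U => dens G r x U * dens G r y U) -
      torusE G r β (L₀ β) (dens G r x) * torusE G r β (L₀ β) (dens G r y))
    (fun x y => C₂ * (a β / κ) ^ 4 / (1 + ‖siteToE (y - x)‖) ^ 4)
    (2 * (C₁ * (a β / κ) ^ 4) * (C₁ * (a β / κ) ^ 4)) hpair
  have e4 : ∑ x ∈ box 4 N, ∑ y ∈ box 4 N, |thetaTest 4 v (a β • siteToE x)| * |v (a β • siteToE y)| *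
      (C₂ * (a β / κ) ^ 4 / (1 + ‖siteToE (y - x)‖) ^ 4) =
      C₂ * (a β / κ) ^ 4 * ∑ x ∈ box 4 N, ∑ y ∈ box 4 N,
        |thetaTest 4 v (a β • siteToE x)| * |v (a β • siteToE y)| / (1 + ‖siteToE (y - x)‖) ^ 4 := by
    rw [Finset.mul_sum]
    refine Finset.sum_congr rfl fun x _ => ?_
    rw [Finset.mul_sum]
    refine Finset.sum_congr rfl fun y _ => ?_
    ring
  rw [eQ (L₀ β) hNL₀, e1, e2, e3] at HRβ
  rw [e4] at hsum
  rw [eQ L hNL]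
  have hprod : 2 * (C₁ * (a β / κ) ^ 4 * ∑ x ∈ box 4 N, |thetaTest 4 v (a β • siteToE x)|) *
      (C₁ * (a β / κ) ^ 4 * ∑ y ∈ box 4 N, |v (a β • siteToE y)|) =
      2 * (C₁ * (a β / κ) ^ 4) * (C₁ * (a β / κ) ^ 4) *
        ((∑ x ∈ box 4 N, |thetaTest 4 v (a β • siteToE x)|) * ∑ y ∈ box 4 N, |v (a β • siteToE y)|) := by ring
  linarith [hsum, HRβ, hprod]

end Torus

end Summit.QuantumFields.YangMills.Cruxes.NT.Reference

end
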